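import Summits.Ventures.DiscreteObjects.PP12.OrderElevenTriangleKernel
import Summits.Ventures.DiscreteObjects.PP12.OrderElevenTriangleRowCode

/-!
# PP(12), order-11 cell, Case B (`NoTriangleData12`): SOUNDNESS of the kernel compatibility test (designs g23)
Framing: lottery ticket; floor = certified bounds/negative ranges.

Cell pub-namedobj (venture DiscreteObjects), target (M). For triangle data `D : TriangleData 11` and two free line orbits `s ≠ s'` satisfying the cross
condition (X) (`TriangleData.CrossOK`, `OrderElevenCollineation`), the kernel test `Triangle12.compat` (`OrderElevenTriangleKernel`) accepts the packed rows:
**`compat_rowCode : D.CrossOK s s' → compat (rowCode D s) (rowCode D s') = true`**. Ingredients: the bit semantics of the shifted-`&&&` word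
`xword D s s' δ = A_s &&& ((A_{s'} ||| A_{s'} <<< 11) >>> δ)` (bit `22 t + e` ⇔ `e ∈ E_{s,t}` and `e + δ ∈ E_{s',t}` mod 11), the soundness of the difference pass `cz`,
and the case analysis of (X). Proofs only; nothing here asserts a census statement. No `sorry`, no new axioms.
-/

namespace Summit.Ventures.DiscreteObjects.PP12

namespace Triangle12

open Fin.CommRing -- `Fin 11` as a commutative ring (scoped Mathlib instance): cyclic residue arithmetic

variable (D : TriangleData 11) (s s' : Fin 11)

/-! ### the shifted-`&&&` word and its bits -/

/-- the word tested by the difference pass at shift `δ` -/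
def xword (dl : ℕ) : ℕ := aword D s &&& ((aword D s' ||| (aword D s' <<< 11)) >>> dl)

/-- **bit semantics of `xword`** (`δ ≤ 10`): bit `p = 22 t + e` is set iff `e ∈ E_{s,t}` and `(e + δ) mod 11 ∈ E_{s',t}` -/
theorem testBit_xword {dl : ℕ} (hdl : dl ≤ 10) (p : ℕ) :
    (xword D s s' dl).testBit p = (decide (p / 22 < 11) && decide (p % 22 < 11) && memN D s (p / 22) (p % 22) &&
      memN D s' (p / 22) ((p % 22 + dl) % 11)) := by
  simp only [xword, Nat.testBit_and, Nat.testBit_shiftRight, Nat.testBit_or, Nat.testBit_shiftLeft, testBit_aword]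
  by_cases ht : p / 22 < 11
  · by_cases he : p % 22 < 11
    · simp only [ht, he, decide_true, Bool.true_and]
      by_cases h3 : p % 22 + dl < 11
      · have e1 : (dl + p) / 22 = p / 22 := by omega
        have e2 : (dl + p) % 22 = p % 22 + dl := by omega
        have e3 : (p % 22 + dl) % 11 = p % 22 + dl := Nat.mod_eq_of_lt h3
        by_cases h4 : dl + p ≥ 11
        · have e4 : ¬ (dl + p - 11) % 22 < 11 := by omega
          simp [e1, e2, e3, ht, h3, h4, e4]
        · simp [e1, e2, e3, ht, h3, h4]
      · have e2 : ¬ (dl + p) % 22 < 11 := by omega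
        have h4 : dl + p ≥ 11 := by omega
        have e5 : (dl + p - 11) / 22 = p / 22 := by omega
        have e6 : (dl + p - 11) % 22 = p % 22 + dl - 11 := by omega
        have e7 : (p % 22 + dl) % 11 = p % 22 + dl - 11 := by omega
        have e8 : p % 22 + dl - 11 < 11 := by omega
        simp [e2, h4, e5, e6, e7, e8, ht]
    · simp [ht, he]
  · simp [ht]

/-- a witness pair makes `xword` non-zero -/
theorem xword_ne_zero {dl t e : ℕ} (hdl : dl ≤ 10) (ht : t < 11) (he : e < 11) (h1 : memN D s t e = true)
    (h2 : memN D s' t ((e + dl) % 11) = true) : xword D s s' dl ≠ 0 := by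
  intro h0
  have hb := testBit_xword D s s' hdl (22 * t + e)
  have e1 : (22 * t + e) / 22 = t := by omega
  have e2 : (22 * t + e) % 22 = e := by omega
  rw [h0, Nat.zero_testBit, e1, e2] at hb
  simp [ht, he, h1, h2] at hb

/-- no witness pair makes `xword` zero -/
theorem xword_eq_zero {dl : ℕ} (hdl : dl ≤ 10)
    (h : ∀ t e, t < 11 → e < 11 → ¬ (memN D s t e = true ∧ memN D s' t ((e + dl) % 11) = true)) : xword D s s' dl = 0 :=
  Nat.zero_of_testBit_eq_false fun p => by
    rw [testBit_xword D s s' hdl]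
    by_cases ht : p / 22 < 11
    · by_cases he : p % 22 < 11
      · have := h _ _ ht he
        simp only [ht, he, decide_true, Bool.true_and, Bool.and_eq_false_imp]
        intro h1 ; by_contra h2; exact this ⟨h1, by simpa using h2⟩
      · simp [he]
    · simp [ht]

/-! ### from (X) to the bits -/

/-- `memN` at natural indices below `11` is `D.mem` -/
theorem memN_mk {t e : ℕ} (ht : t < 11) (he : e < 11) : memN D s t e = D.mem s ⟨t, ht⟩ ⟨e, he⟩ := by
  simp [memN, ht, he]

/-- `PairNone s s' (−δ)` kills the word at shift `δ` -/
theorem xword_eq_zero_of_pairNone {dl : ℕ} (hdl : dl ≤ 10) (h : D.PairNone s s' (-(⟨dl, by omega⟩ : Fin 11))) :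
    xword D s s' dl = 0 := by
  refine xword_eq_zero D s s' hdl fun t e ht he ⟨h1, h2⟩ => h ⟨t, ht⟩ ⟨e, he⟩ ⟨?_, ?_⟩
  · rwa [memN_mk D s ht he] at h1
  · have hval : ((⟨e, he⟩ : Fin 11) - -(⟨dl, by omega⟩ : Fin 11)).val = (e + dl) % 11 := by
      rw [sub_neg_eq_add, Fin.val_add]
    have hlt : (e + dl) % 11 < 11 := Nat.mod_lt _ (by norm_num)
    rw [memN_mk D s' ht hlt] at h2
    convert h2 using 2
    exact Fin.ext hval

/-- `PairOne s s' (−δ)` makes the word at shift `δ` non-zero -/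
theorem xword_ne_zero_of_pairOne {dl : ℕ} (hdl : dl ≤ 10) (h : D.PairOne s s' (-(⟨dl, by omega⟩ : Fin 11))) :
    xword D s s' dl ≠ 0 := by
  obtain ⟨t, x, h1, h2, -⟩ := h
  have hval : (x - -(⟨dl, by omega⟩ : Fin 11)).val = (x.val + dl) % 11 := by rw [sub_neg_eq_add, Fin.val_add]
  refine xword_ne_zero D s s' hdl t.isLt x.isLt (by rw [memN_mk D s t.isLt x.isLt]; exact h1) ?_
  have hlt : (x.val + dl) % 11 < 11 := Nat.mod_lt _ (by norm_num)
  rw [memN_mk D s' t.isLt hlt]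
  convert h2 using 2
  exact Fin.ext hval.symm

/-! ### the difference pass -/

/-- soundness of `cz`: if the word vanishes exactly at the prescribed shifts, the pass returns `true` -/
theorem cz_true (A B2 d1 d2 : ℕ)
    (h : ∀ dl, dl ≤ 10 → ((dl = 0 ∨ dl = d1 ∨ dl = d2) → A &&& (B2 >>> dl) = 0) ∧
      (¬ (dl = 0 ∨ dl = d1 ∨ dl = d2) → A &&& (B2 >>> dl) ≠ 0)) :
    ∀ c, c ≤ 11 → cz A B2 d1 d2 c = true
  | 0, _ => rfl
  | c + 1, hc => by
    rw [cz, cz_true A B2 d1 d2 h c (by omega), Bool.and_true]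
    obtain ⟨h1, h2⟩ := h (10 - c) (by omega)
    by_cases hz : (10 - c = 0 ∨ 10 - c = d1 ∨ 10 - c = d2)
    · have hc' : ((10 - c == 0) || (10 - c == d1) || (10 - c == d2)) = true := by
        simpa [Bool.or_eq_true, beq_iff_eq, or_assoc] using hz
      rw [if_pos hc']; simpa using h1 hz
    · have hc' : ¬ ((10 - c == 0) || (10 - c == d1) || (10 - c == d2)) = true := by
        simpa [Bool.or_eq_true, beq_iff_eq, or_assoc] using hz
      rw [if_neg hc']; simpa [bne_iff_ne] using h2 hz

/-! ### the main soundness theorem -/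

/-- the residue `(b + 11 − a) mod 11` is the value of `b − a` in `Fin 11` -/
theorem val_sub_eq (a b : Fin 11) : (b - a).val = (b.val + 11 - a.val) % 11 := by
  have h := Fin.val_add a (b - a)
  rw [add_sub_cancel] at h
  have ha := a.isLt; have hb := b.isLt; have hab := (b - a).isLt
  omega

/-- **soundness of `compat`**: two free line orbits of triangle data satisfying (X) have compatible packed rows -/
theorem compat_rowCode {s s' : Fin 11} (hX : D.CrossOK s s') : compat (rowCode D s) (rowCode D s') = true := by
  obtain ⟨hg1, hg2, hp0, hδ⟩ := hX
  -- the two side differences are distinct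
  have hΔ : D.g1 s - D.g1 s' ≠ D.g2 s - D.g2 s' := by
    rcases hδ _ (sub_ne_zero.2 hg1) with ⟨_, b, _⟩ | ⟨a, _, _⟩ | ⟨a, _, _⟩
    · exact fun e => b e.symm
    · exact (a rfl).elim
    · exact (a rfl).elim
  unfold compat
  rw [rowCode_shiftRight_four_and_15, rowCode_shiftRight_four_and_15, rowCode_and_15, rowCode_and_15, rowCode_shiftRight_eight,
    rowCode_shiftRight_eight, ← val_sub_eq, ← val_sub_eq]
  have n1 : ((D.g1 s).val == (D.g1 s').val) = false := by simpa [beq_eq_false_iff_ne] using fun e => hg1 (Fin.ext e)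
  have n2 : ((D.g2 s).val == (D.g2 s').val) = false := by simpa [beq_eq_false_iff_ne] using fun e => hg2 (Fin.ext e)
  have n3 : ((D.g1 s' - D.g1 s).val == (D.g2 s' - D.g2 s).val) = false := by
    simpa [beq_eq_false_iff_ne] using fun e => hΔ (by have := Fin.ext e; linear_combination -this)
  simp only [n1, n2, n3, Bool.not_false, Bool.true_and]
  refine cz_true _ _ _ _ (fun dl hdl => ?_) 11 le_rfl
  -- the word at shift `dl` is `xword D s s' dl`; set `δ' = −dl`
  show ((dl = 0 ∨ dl = (D.g1 s' - D.g1 s).val ∨ dl = (D.g2 s' - D.g2 s).val) → xword D s s' dl = 0) ∧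
    (¬ (dl = 0 ∨ dl = (D.g1 s' - D.g1 s).val ∨ dl = (D.g2 s' - D.g2 s).val) → xword D s s' dl ≠ 0)
  set d : Fin 11 := ⟨dl, by omega⟩ with hd
  have hd0 : dl = 0 ↔ -d = 0 := by
    rw [neg_eq_zero, Fin.ext_iff]; exact Iff.rfl
  have hd1 : dl = (D.g1 s' - D.g1 s).val ↔ -d = D.g1 s - D.g1 s' := by
    rw [neg_eq_iff_eq_neg, neg_sub, Fin.ext_iff]
  have hd2 : dl = (D.g2 s' - D.g2 s).val ↔ -d = D.g2 s - D.g2 s' := by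
    rw [neg_eq_iff_eq_neg, neg_sub, Fin.ext_iff]
  rw [hd0, hd1, hd2]
  by_cases hz : -d = 0
  · refine ⟨fun _ => xword_eq_zero_of_pairNone D s s' hdl (by rw [← hd, hz]; exact hp0), fun hn => (hn (Or.inl hz)).elim⟩
  rcases hδ (-d) hz with ⟨a, b, c⟩ | ⟨a, b, c⟩ | ⟨a, b, c⟩
  · exact ⟨fun _ => xword_eq_zero_of_pairNone D s s' hdl c, fun hn => (hn (Or.inr (Or.inl a.symm))).elim⟩
  · exact ⟨fun _ => xword_eq_zero_of_pairNone D s s' hdl c, fun hn => (hn (Or.inr (Or.inr b.symm))).elim⟩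
  · refine ⟨fun hy => ?_, fun _ => xword_ne_zero_of_pairOne D s s' hdl c⟩
    rcases hy with h | h | h
    · exact (hz h).elim
    · exact (a h.symm).elim
    · exact (b h.symm).elim

/-! ### the scan: from the run files' `scanG` slices to a contradiction -/

/-- a passed slice gives `rowOK` for the rows whose `g₁` digit lies in it -/
theorem rowOK_of_scanG {rows : List ℕ} {lo hi a : ℕ} (h : scanG rows lo hi = true) (ha : a ∈ rows)
    (hlo : lo ≤ (a >>> 4) &&& 15) (hhi : (a >>> 4) &&& 15 < hi) : rowOK rows a = true := by
  unfold scanG at h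
  rw [List.all_eq_true] at h
  exact h a (List.mem_filter.2 ⟨ha, by simp [hlo, hhi]⟩)

/-- the `g₁` digit is `< 16` -/
theorem digit_lt_16 (a : ℕ) : (a >>> 4) &&& 15 < 16 :=
  lt_of_le_of_lt (Nat.and_le_right) (by norm_num)

/-- two slices covering `[0, 16)` give `rowOK` everywhere -/
theorem scan_cover2 {rows : List ℕ} {m : ℕ} (h1 : scanG rows 0 m = true) (h2 : scanG rows m 16 = true) :
    ∀ a ∈ rows, rowOK rows a = true := fun a ha => by
  by_cases hm : (a >>> 4) &&& 15 < m
  · exact rowOK_of_scanG h1 ha (Nat.zero_le _) hm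
  · exact rowOK_of_scanG h2 ha (not_lt.1 hm) (digit_lt_16 a)

/-- three slices covering `[0, 16)` give `rowOK` everywhere -/
theorem scan_cover3 {rows : List ℕ} {m n : ℕ} (h1 : scanG rows 0 m = true) (h2 : scanG rows m n = true)
    (h3 : scanG rows n 16 = true) : ∀ a ∈ rows, rowOK rows a = true := fun a ha => by
  by_cases hm : (a >>> 4) &&& 15 < m
  · exact rowOK_of_scanG h1 ha (Nat.zero_le _) hm
  by_cases hn : (a >>> 4) &&& 15 < n
  · exact rowOK_of_scanG h2 ha (not_lt.1 hm) hn
  · exact rowOK_of_scanG h3 ha (not_lt.1 hn) (digit_lt_16 a)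

/-- four slices covering `[0, 16)` give `rowOK` everywhere -/
theorem scan_cover4 {rows : List ℕ} {m n o : ℕ} (h1 : scanG rows 0 m = true) (h2 : scanG rows m n = true)
    (h3 : scanG rows n o = true) (h4 : scanG rows o 16 = true) : ∀ a ∈ rows, rowOK rows a = true := fun a ha => by
  by_cases hm : (a >>> 4) &&& 15 < m
  · exact rowOK_of_scanG h1 ha (Nat.zero_le _) hm
  by_cases hn : (a >>> 4) &&& 15 < n
  · exact rowOK_of_scanG h2 ha (not_lt.1 hm) hn
  by_cases ho : (a >>> 4) &&& 15 < o
  · exact rowOK_of_scanG h3 ha (not_lt.1 hn) ho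
  · exact rowOK_of_scanG h4 ha (not_lt.1 ho) (digit_lt_16 a)

/-- the row code determines `g₁`, hence the orbit, for valid data -/
theorem rowCode_injective (hV : D.Valid) : Function.Injective (rowCode D) := fun s s' e => by
  by_contra hne
  have h := congrArg (fun r => (r >>> 4) &&& 15) e
  simp only [rowCode_shiftRight_four_and_15] at h
  exact (hV.2.2 s s' hne).1 (Fin.ext h)

/-- **no valid data whose rows are all listed in a list that passes the scan**: row `0` would have the ten distinct compatible partners
`rowCode D s`, `s ≠ 0`, among the listed rows, but `rowOK` says it has fewer than ten -/
theorem noValid_of_scan (rows : List ℕ) (hscan : ∀ a ∈ rows, rowOK rows a = true) (hV : D.Valid)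
    (hmem : ∀ s, rowCode D s ∈ rows) : False := by
  classical
  have hrow := hscan _ (hmem 0)
  unfold rowOK at hrow
  simp only [decide_eq_true_eq] at hrow
  -- the ten partners
  let S : Finset ℕ := (Finset.univ.erase (0 : Fin 11)).image (rowCode D)
  have hcard : S.card = 10 := by
    rw [Finset.card_image_of_injective _ (rowCode_injective D hV), Finset.card_erase_of_mem (Finset.mem_univ _)]
    simp
  have hsub : S ⊆ (rows.filter (compat (rowCode D 0))).toFinset := by
    intro x hx
    obtain ⟨s, hs, rfl⟩ := Finset.mem_image.1 hx
    have hs0 : s ≠ 0 := (Finset.mem_erase.1 hs).1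
    rw [List.mem_toFinset, List.mem_filter]
    exact ⟨hmem s, compat_rowCode D (hV.2.2 0 s (Ne.symm hs0))⟩
  have := (Finset.card_le_card hsub).trans (List.toFinset_card_le _)
  rw [hcard] at this
  omega

end Triangle12

end Summit.Ventures.DiscreteObjects.PP12
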